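/-
Copyright (c) 2026 the pub-hodgecm-mathlib formalisation cell (harness21).  Prover seat hodgecm-mathlib-K2Liu-p10 (g4), Track B «K2-LIT»,
#184♮ = hLiu418 = `stmt-HodgeConjecture-24832`; letter (L2) of RULING M-158d ∕ BATCH #5 (LEAD F0P6-plan (g14) 11:40:22Z): the LOCAL `H_v`-equivariance of the
Kudla–Rallis map — file (L2-a′) «THE SWAP WEYL ELEMENT OF AN ANTISYMMETRIC GRAM MODEL IS IMPLEMENTED BY THE `β`-FOURIER TRANSFORM».  KERNEL: theorems only.
-/
import Summits.HodgeConjecture.HodgeConjecture.Theorems.K2LiuKudlaRallisMapDeltaModel        -- ★ A2c (`implementerUniqueUpToScalar_localSchrodingerDelta`; brings β-1, β-3, Weil's generators, `MpPsi.toRep`)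
import Summits.HodgeConjecture.HodgeConjecture.Theorems.K2LiuDeltaSpTransportWeylLetter     -- ★ A2d-3 (`deltaGram_transpose`, `toLinearMap₂'_deltaGram_swap`: the Weyl letter of `w_Δ` is the swap)
import Literature.NumberTheory.Automorphic.LocalPiSchwartzBruhatFourier                     -- ★ `piFourierSB`, `piFourierSB_mem_schwartzBruhat`, `piFourierSB_piFourierSB_eq`, `piSelfDualConstUnit`
import Mathlib.LinearAlgebra.Matrix.ToLinearEquiv
import HarnessLib

/-!
# Crux `HLiu418`, letter (L2), file (L2-a′): THE SWAP `(x, y) ↦ (y, x)` OF AN ANTISYMMETRIC GRAM SCHRÖDINGER MODEL IS IMPLEMENTED BY THE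
# `β`-FOURIER TRANSFORM, hence every pair over it acts by `c • betaFourier β_J ψ μ` (implementer uniqueness)

Cell `hodgecm-mathlib`, crux item hLiu418 = `stmt-HodgeConjecture-24832`, route of record `HCCMUnconditional`; squad K2 ∕ K2Liu, prover K2Liu-p10 (g4).
THEOREMS ONLY (no `def`, no `instance`, no notation, no named-fact hypothesis, no `sorry`); lane `--supports stmt-HodgeConjecture-24832 --as helper`.

WHY THIS FILE (census K2Liu-p10 (g4) 11:42Z).  In (β-1)'s doubling-polarised model ★ `localSchrodingerDelta` the Gram matrix `J_Δ` is ANTISYMMETRIC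
(★ `deltaGram_transpose`) and the Weyl element `w_Δ` of the doubled group reads, in `ℓ_Δ`-coordinates, as THE SWAP `weylSp β_{J_Δ} id id`
(★ A2d-3 `deltaTransport_iotaD_weylDelta_eq_weylSp`).  The tree's Weyl implementer ★ `weylEquivSB β ψ μ γ … hW c hinv` demands Weil's inversion in the
REFLECTION form `W(W f) = c • f(−·)`; but for `γ = id` and antisymmetric `J` one has `W = betaFourier β_J` and `W ∘ W = c′ • id` (the swap is an
involution), so that packaging is not instantiable at the swap.  REPAIR, inside Weil's generators [Weil1964, n° 6, n° 13; MVW Chap. 2 II.6]: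
with `γ_J : y ↦ J y`,

  `swap = m(J⁻¹·, −J·) · w(γ_J, −γ_J⁻¹)`     (uses `Jᵀ = −J`),     `weylFun β_J ψ μ γ_J = piFourierSB ψ μ`  ON THE NOSE,

so Weil's (i) stability ∕ (ii) inversion for `w(γ_J, −γ_J⁻¹)` ARE the tree's theorems ★ `piFourierSB_mem_schwartzBruhat` ∕ ★ `piFourierSB_piFourierSB_eq`, the
product of the two ★ members (★ `levi_mem_MpPsi`, ★ `weyl_mem_MpPsi`) implements the swap, and its underlying operator is EXACTLY
`f ↦ betaFourier β_J ψ μ f` (`(u ↦ Φ̂(J u))`).  By implementer uniqueness (★ `ImplementerUniqueUpToScalar`, a theorem for the models of record ★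
`implementerUniqueUpToScalar_localSchrodingerDelta`) every pair `p ∈ S̃p_ψ` over the swap acts by `c • betaFourier β_J ψ μ` — the shape the ★ Fourier clause
`K2LiuKudlaRallisMapFourier.krFun_betaFourier_eq` consumes in file (L2) `K2LiuKudlaRallisMapWeylEquivariance`.

* §1 (any model `ρ` with unique implementers) `exists_toRep_eq_smul_of_mem`: a pair `p` over `g` acts by `c • M` for ANY `(g, M) ∈ S̃p_ψ`.
* §2 (linear algebra of `β_J = Matrix.toLinearMap₂' K J`, `γ_J y = J y`) `toLinearMap₂'_swap_eq_neg`, `weyl_rel`, `levi_rel`, **`leviSp_mul_weylSp_eq_swap`** (`Jᵀ = −J`).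
* §3 (a non-archimedean local field `K`) `betaFourier_toLinearMap₂'_apply`, `weylFun_eq_piFourierSB`, Weil's data `weylFun_mem` (i) and `weylFun_weylFun` (ii)
  DISCHARGED, and **`weylPair_mem_MpPsi`**: `(w(γ_J, −γ_J⁻¹), weylEquivSB …) ∈ S̃p_ψ(β_J)`.
* §4 (`Jᵀ = −J`, `det J` a unit) **`exists_swap_implementer_coe_eq_betaFourier`**, **`exists_toRep_eq_smul_betaFourier`**.
* §5 BY NAME at ★ β-1 `localSchrodingerDelta L e dV dW v` (★ `deltaGram_transpose`, ★ `isUnit_det_deltaGram`, ★ `isUnit_det_gramRLoc`):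
  **`exists_toRep_localSchrodingerDelta_eq_smul_betaFourier`** — every `p : LocalMpDelta v` over the swap acts on `𝒮(X_Δ)` by `c • betaFourier β_{J_{Δ,v}} ψ_v μ`.

HONEST LABEL: HC_CM is proved only modulo the 7 printed citations (2 remaining named inputs: hLiu418 = stmt-HodgeConjecture-24832, h413 = stmt-HodgeConjecture-24833)
until rung 0 closes; helper, closes no item.
References: [Weil1964] A. Weil, Acta Math. 111 (1964), n° 6 (p. 151: `d₀′(γ)`, `m(a)`), n° 13 (p. 160: `d₀′(γ)Φ = |γ|^{1/2} Φ*(−xγ*⁻¹)`);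
[MoeglinVignerasWaldspurger1987] Chap. 2 II.1 (A)(B) («M est unique à un scalaire près»), II.6; [WeilBNT1967] Ch. VII §2 Prop. 2, Cor. 1; [Kudla1994] §2, §3 Thm. 3.1;
[HarrisKudlaSweet1996] §1 (1.11); [GanQiuTakeda2014] §2.8.
-/

set_option autoImplicit false
set_option linter.dupNamespace false -- the mandated namespace repeats `HodgeConjecture.HodgeConjecture`

noncomputable section

open MeasureTheory Matrix Topology
open NumberField IsDedekindDomain
open Literature.NumberTheory.GaloisRepresentations.IsNonarchimedeanLocalField
open Literature.NumberTheory.Automorphic Literature.RepresentationTheory.HeisenbergGroup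
open Literature.NumberTheory.GelbartRogawski1991 Literature.NumberTheory.GelbartRogawski1991.GRConstruction
open Summit.HodgeConjecture.HodgeConjecture.Cruxes.HLiu418.K2LiuDoublingSchrodingerModelDefs
open Summit.HodgeConjecture.HodgeConjecture.Cruxes.HLiu418.K2LiuDoublingModelComparison
open Summit.HodgeConjecture.HodgeConjecture.Cruxes.HLiu418.K2LiuKudlaRallisMapDeltaModel
open Summit.HodgeConjecture.HodgeConjecture.Cruxes.HLiu418.K2LiuDeltaSpTransportWeylLetter

namespace Summit.HodgeConjecture.HodgeConjecture.Cruxes.HLiu418.K2LiuSchrodingerSwapWeylImplementer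

universe u v u' v'

/-! ## §1 A pair over `g` acts by a scalar multiple of ANY implementer of `g` -/

section Generic

variable {R : Type u} [CommRing R] [Invertible (2 : R)] {V : Type v} [AddCommGroup V] [Module R V] {B : V →ₗ[R] V →ₗ[R] R}
  {k : Type u'} [Field k] {S : Type v'} [AddCommGroup S] [Module k S] (ρ : Representation k (Heisenberg B) S)

/-- **THE JUNCTION PIN, GENERAL FORM**: if implementers of `ρ` are unique up to scalars and `(g, M) ∈ S̃p_ψ` is ANY pair over `g`, then every `p ∈ S̃p_ψ`
over `g` acts by `toRep p = c • M`, `c` a unit. [cite: MoeglinVignerasWaldspurger1987, Chap. 2 II.1 (A)(B)] -/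
theorem exists_toRep_eq_smul_of_mem (hU : ImplementerUniqueUpToScalar ρ) {g : symplecticGroup B} {M : S ≃ₗ[k] S} (hM : (g, M) ∈ MpPsi ρ)
    (p : MpPsi ρ) (hp : MpPsi.proj ρ p = g) : ∃ c : kˣ, ∀ f : S, MpPsi.toRep ρ p f = (c : k) • M f := by
  have h1 : Implements ρ (ofSymplectic B g) M := (mem_MpPsi ρ _).1 hM
  have h2 : Implements ρ (ofSymplectic B g) (MpPsi.toOp ρ p) := by
    have h := MpPsi.toRep_implements ρ p
    rwa [← MpPsi.proj_apply, hp] at h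
  obtain ⟨c, hc⟩ := hU _ _ _ h1 h2
  exact ⟨c, fun f => hc f⟩

end Generic

/-! ## §2 Linear algebra of a Gram pairing `β_J = Matrix.toLinearMap₂' K J` and of `γ_J : y ↦ J y` -/

section GramAlgebra

variable {K : Type*} [Field K] {ι : Type*} [Fintype ι] [DecidableEq ι] (J : Matrix ι ι K)

/-- **`β_J(y, x) = −β_J(x, y)` for `Jᵀ = −J`** (the relation making the swap `weylSp β_J id id` an element of `Sp`). [cite: Kudla1994, §2] -/
theorem toLinearMap₂'_swap_eq_neg (hJt : Jᵀ = -J) (x y : ι → K) :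
    Matrix.toLinearMap₂' K J (LinearEquiv.refl K (ι → K) y) (LinearEquiv.refl K (ι → K) x) = -Matrix.toLinearMap₂' K J x y := by
  rw [LinearEquiv.refl_apply, LinearEquiv.refl_apply, Matrix.toLinearMap₂'_apply', Matrix.toLinearMap₂'_apply', Matrix.dotProduct_mulVec,
    ← Matrix.mulVec_transpose, hJt, Matrix.neg_mulVec, neg_dotProduct, dotProduct_comm]

/-- the linear automorphism `γ_J : y ↦ J y` of `K^ι` exists as soon as `det J` is a unit. [folklore] -/
theorem exists_linearEquiv_eq_mulVec (hJ : IsUnit J.det) : ∃ γ : (ι → K) ≃ₗ[K] (ι → K), ∀ y, γ y = J *ᵥ y := by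
  refine ⟨Matrix.toLinearEquiv' J (Matrix.invertibleOfIsUnitDet J hJ), fun y => ?_⟩
  exact (LinearMap.congr_fun (Matrix.toLinearEquiv'_apply J (Matrix.invertibleOfIsUnitDet J hJ)) y).trans (Matrix.toLin'_apply J y)

omit [DecidableEq ι] in
/-- `J (γ_J⁻¹ u) = u`. [folklore] -/
theorem mulVec_symm_apply (γ : (ι → K) ≃ₗ[K] (ι → K)) (hγ : ∀ y, γ y = J *ᵥ y) (u : ι → K) : J *ᵥ γ.symm u = u := by
  rw [← hγ, LinearEquiv.apply_symm_apply]

/-- **Weil's relation for `(γ_J, −γ_J⁻¹)`**: `β_J(γ_J y, −γ_J⁻¹ x) = −β_J(x, y)` (no symmetry of `J` needed). [cite: Weil1964, n° 6, p. 151] -/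
theorem weyl_rel (γ : (ι → K) ≃ₗ[K] (ι → K)) (hγ : ∀ y, γ y = J *ᵥ y) (x y : ι → K) :
    Matrix.toLinearMap₂' K J (γ y) ((γ.symm ≪≫ₗ LinearEquiv.neg K) x) = -Matrix.toLinearMap₂' K J x y := by
  rw [LinearEquiv.trans_apply, LinearEquiv.neg_apply, map_neg, Matrix.toLinearMap₂'_apply', Matrix.toLinearMap₂'_apply', mulVec_symm_apply J γ hγ, hγ,
    dotProduct_comm]

/-- the Levi relation for `(a, d) = (J⁻¹·, −J·)`: `β_J(J⁻¹x, −Jy) = β_J(x, y)` when `Jᵀ = −J`. [cite: Weil1964, n° 6, p. 151] -/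
theorem levi_rel (hJt : Jᵀ = -J) (γ : (ι → K) ≃ₗ[K] (ι → K)) (hγ : ∀ y, γ y = J *ᵥ y) (x y : ι → K) :
    Matrix.toLinearMap₂' K J (γ.symm x) ((γ ≪≫ₗ LinearEquiv.neg K) y) = Matrix.toLinearMap₂' K J x y := by
  rw [LinearEquiv.trans_apply, LinearEquiv.neg_apply, map_neg, Matrix.toLinearMap₂'_apply', Matrix.toLinearMap₂'_apply', hγ, Matrix.dotProduct_mulVec,
    ← Matrix.mulVec_transpose, hJt, Matrix.neg_mulVec, mulVec_symm_apply J γ hγ, neg_dotProduct, neg_neg]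

/-- **THE SWAP FACTORS THROUGH WEIL's GENERATORS**: `m(J⁻¹·, −J·) · w(γ_J, −γ_J⁻¹) = weylSp β_J id id` (`(x, y) ↦ (J y, −J⁻¹ x) ↦ (y, x)`), for `Jᵀ = −J`.
[cite: Weil1964, n° 6, p. 151] [cite: Kudla1994, §3] -/
theorem leviSp_mul_weylSp_eq_swap [Invertible (2 : K)] (hJt : Jᵀ = -J) (γ : (ι → K) ≃ₗ[K] (ι → K)) (hγ : ∀ y, γ y = J *ᵥ y) :
    leviSp (Matrix.toLinearMap₂' K J) γ.symm (γ ≪≫ₗ LinearEquiv.neg K) (levi_rel J hJt γ hγ) *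
        weylSp (Matrix.toLinearMap₂' K J) γ (γ.symm ≪≫ₗ LinearEquiv.neg K) (weyl_rel J γ hγ) =
      weylSp (Matrix.toLinearMap₂' K J) (LinearEquiv.refl K (ι → K)) (LinearEquiv.refl K (ι → K)) (toLinearMap₂'_swap_eq_neg J hJt) := by
  apply Subtype.ext
  refine LinearEquiv.ext fun p => ?_
  obtain ⟨x, y⟩ := p
  rw [Subgroup.coe_mul, LinearEquiv.mul_apply, coe_weylSp, coe_weylSp, weylσ_apply, weylσ_apply, coe_leviSp_apply]
  simp only [LinearEquiv.trans_apply, LinearEquiv.neg_apply, LinearEquiv.refl_apply, LinearEquiv.symm_apply_apply, map_neg, LinearEquiv.apply_symm_apply,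
    neg_neg]

end GramAlgebra

/-! ## §3 The Weyl pair `(w(γ_J, −γ_J⁻¹), Φ ↦ Φ̂)` of a Gram model over a non-archimedean local field: Weil's (i), (ii) DISCHARGED -/

section GramFourier

variable {K : Type*} [Field K] [ValuativeRel K] [TopologicalSpace K] [IsNonarchimedeanLocalField K]
  {ι : Type*} [Fintype ι] [DecidableEq ι] (J : Matrix ι ι K) (ψ : AddChar K Circle)
  [MeasurableSpace (ι → K)] (μ : Measure (ι → K)) {m : ℤ}

omit [ValuativeRel K] [TopologicalSpace K] [IsNonarchimedeanLocalField K] in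
/-- **`betaFourier β_J ψ μ f (w) = f̂(J w)`** (`f̂ = piFourierSB ψ μ f`). [cite: MoeglinVignerasWaldspurger1987, Chap. 2 II.6] [cite: WeilBNT1967, Ch. VII §2, Prop. 2] -/
theorem betaFourier_toLinearMap₂'_apply (f : (ι → K) → ℂ) (w : ι → K) :
    betaFourier (Matrix.toLinearMap₂' K J) ψ μ f w = piFourierSB ψ μ f (J *ᵥ w) := by
  rw [betaFourier_apply, piFourierSB_apply]
  simp only [Matrix.toLinearMap₂'_apply']

omit [ValuativeRel K] [TopologicalSpace K] [IsNonarchimedeanLocalField K] in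
/-- **`weylFun β_J ψ μ γ_J = piFourierSB ψ μ` ON THE NOSE**: `(W f)(u) = ∫ ψ(v ⬝ J(J⁻¹u)) f(v) dμ(v) = f̂(u)`. [cite: Weil1964, n° 13, p. 160] -/
theorem weylFun_eq_piFourierSB (γ : (ι → K) ≃ₗ[K] (ι → K)) (hγ : ∀ y, γ y = J *ᵥ y) (f : (ι → K) → ℂ) :
    weylFun (Matrix.toLinearMap₂' K J) ψ μ γ f = piFourierSB ψ μ f := by
  funext u
  rw [weylFun, Function.comp_apply, betaFourier_toLinearMap₂'_apply, mulVec_symm_apply J γ hγ]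

variable [BorelSpace (ι → K)] [μ.IsAddHaarMeasure]

/-- Weil's datum (i) DISCHARGED: `W f ∈ 𝒮(K^ι)` for `f ∈ 𝒮(K^ι)` (★ `piFourierSB_mem_schwartzBruhat`). [cite: Weil1964, n° 11, p. 157] [cite: WeilBNT1967, Ch. VII §2, Prop. 2] -/
theorem weylFun_mem (hψ : ψ.IsContinuousNontrivial) (γ : (ι → K) ≃ₗ[K] (ι → K)) (hγ : ∀ y, γ y = J *ᵥ y) (f : SchwartzBruhat (ι → K)) :
    weylFun (Matrix.toLinearMap₂' K J) ψ μ γ f ∈ SchwartzBruhat (ι → K) := by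
  rw [weylFun_eq_piFourierSB J ψ μ γ hγ]
  exact piFourierSB_mem_schwartzBruhat μ hψ f.2

/-- Weil's datum (ii) DISCHARGED: `W (W f) = c • f(−·)` on `𝒮(K^ι)`, `c = μ(𝒪^ι) μ((𝔭^m)^ι)` (★ `piFourierSB_piFourierSB_eq`). [cite: WeilBNT1967, Ch. VII §2, Cor. 1] -/
theorem weylFun_weylFun (hψ : ψ.IsContinuousNontrivial) (hm : ψ.HasConductorExp m) (γ : (ι → K) ≃ₗ[K] (ι → K)) (hγ : ∀ y, γ y = J *ᵥ y)
    (f : SchwartzBruhat (ι → K)) :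
    weylFun (Matrix.toLinearMap₂' K J) ψ μ γ (weylFun (Matrix.toLinearMap₂' K J) ψ μ γ f) = ((piSelfDualConstUnit μ m : ℂˣ) : ℂ) • fun u => (f : (ι → K) → ℂ) (-u) := by
  rw [weylFun_eq_piFourierSB J ψ μ γ hγ, weylFun_eq_piFourierSB J ψ μ γ hγ, piFourierSB_piFourierSB_eq μ hψ hm f.2, coe_piSelfDualConstUnit]
  funext u
  simp only [Pi.smul_apply, smul_eq_mul]

variable [Invertible (2 : K)]

/-- **THE WEYL PAIR OF A GRAM MODEL**: `(w(γ_J, −γ_J⁻¹), weylEquivSB β_J ψ μ γ_J) ∈ S̃p_ψ(β_J)` — ★ `weyl_mem_MpPsi` with Weil's (i), (ii) supplied above; the operator IS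
`Φ ↦ Φ̂` by `weylFun_eq_piFourierSB`. [cite: Weil1964, n° 13, p. 160] [cite: MoeglinVignerasWaldspurger1987, Chap. 2 II.6] -/
theorem weylPair_mem_MpPsi (hψ : ψ.IsContinuousNontrivial) (hm : ψ.HasConductorExp m)
    (hb : ∀ y : ι → K, Continuous fun u : ι → K => Matrix.toLinearMap₂' K J u y) (γ : (ι → K) ≃ₗ[K] (ι → K)) (hγ : ∀ y, γ y = J *ᵥ y) :
    (weylSp (Matrix.toLinearMap₂' K J) γ (γ.symm ≪≫ₗ LinearEquiv.neg K) (weyl_rel J γ hγ),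
      weylEquivSB (Matrix.toLinearMap₂' K J) ψ μ γ (isLocallyConstant_of_isContinuousNontrivial hψ) hb (weylFun_mem J ψ μ hψ γ hγ)
        (piSelfDualConstUnit μ m) (weylFun_weylFun J ψ μ hψ hm γ hγ)) ∈
      MpPsi (schrodingerSB (Matrix.toLinearMap₂' K J) ψ (isLocallyConstant_of_isContinuousNontrivial hψ) hb) :=
  weyl_mem_MpPsi (Matrix.toLinearMap₂' K J) ψ μ (isLocallyConstant_of_isContinuousNontrivial hψ) hb γ (γ.symm ≪≫ₗ LinearEquiv.neg K) (weyl_rel J γ hγ)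
    (weylFun_mem J ψ μ hψ γ hγ) (piSelfDualConstUnit μ m) (weylFun_weylFun J ψ μ hψ hm γ hγ)

/-! ## §4 Antisymmetric `J`: the swap is implemented by `betaFourier β_J ψ μ`; every pair over it acts by `c • betaFourier β_J ψ μ` -/

/-- **AN IMPLEMENTER OF THE SWAP WHOSE OPERATOR IS THE `β_J`-FOURIER TRANSFORM**: for `J ∈ GL_ι(K)` with `Jᵀ = −J` there is `M ∈ GL(𝒮(K^ι))` with
`(weylSp β_J id id, M) ∈ S̃p_ψ(β_J)` and `(M f)(u) = betaFourier β_J ψ μ f (u) = f̂(J u)` — `M = leviEquivSB(J⁻¹·) ∘ weylEquivSB(γ_J)` (★ `levi_mem_MpPsi` · §3, product in `S̃p_ψ`).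
[cite: Weil1964, n° 13, p. 160] [cite: MoeglinVignerasWaldspurger1987, Chap. 2 II.1 (A), II.6] -/
theorem exists_swap_implementer_coe_eq_betaFourier (hψ : ψ.IsContinuousNontrivial) (hJ : IsUnit J.det) (hJt : Jᵀ = -J)
    (hb : ∀ y : ι → K, Continuous fun u : ι → K => Matrix.toLinearMap₂' K J u y) :
    ∃ M : SchwartzBruhat (ι → K) ≃ₗ[ℂ] SchwartzBruhat (ι → K),
      (weylSp (Matrix.toLinearMap₂' K J) (LinearEquiv.refl K (ι → K)) (LinearEquiv.refl K (ι → K)) (toLinearMap₂'_swap_eq_neg J hJt), M) ∈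
          MpPsi (schrodingerSB (Matrix.toLinearMap₂' K J) ψ (isLocallyConstant_of_isContinuousNontrivial hψ) hb) ∧
        ∀ f : SchwartzBruhat (ι → K), ((M f : SchwartzBruhat (ι → K)) : (ι → K) → ℂ) = betaFourier (Matrix.toLinearMap₂' K J) ψ μ f := by
  obtain ⟨m, hm⟩ := hψ.exists_hasConductorExp
  obtain ⟨γ, hγ⟩ := exists_linearEquiv_eq_mulVec J hJ
  have hγc : Continuous γ := (γ : (ι → K) →ₗ[K] (ι → K)).continuous_on_pi
  have hac : Continuous γ.symm := (γ.symm : (ι → K) →ₗ[K] (ι → K)).continuous_on_pi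
  have hac' : Continuous γ.symm.symm := by rw [LinearEquiv.symm_symm]; exact hγc
  have hL := levi_mem_MpPsi (Matrix.toLinearMap₂' K J) ψ (isLocallyConstant_of_isContinuousNontrivial hψ) hb γ.symm (γ ≪≫ₗ LinearEquiv.neg K)
    (levi_rel J hJt γ hγ) hac hac'
  have hW := weylPair_mem_MpPsi J ψ μ hψ hm hb γ hγ
  have hprod := Subgroup.mul_mem _ hL hW
  rw [Prod.mk_mul_mk, leviSp_mul_weylSp_eq_swap J hJt γ hγ] at hprod
  refine ⟨_, hprod, fun f => ?_⟩
  funext u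
  rw [LinearEquiv.mul_apply, coe_leviEquivSB, leviOp_apply, coe_weylEquivSB, LinearEquiv.symm_symm, weylFun, Function.comp_apply, LinearEquiv.symm_apply_apply]

/-- **EVERY PAIR OVER THE SWAP ACTS BY `c • betaFourier β_J ψ μ`** (implementer uniqueness ★ `ImplementerUniqueUpToScalar` + the implementer above): for `p ∈ S̃p_ψ(β_J)`
with `proj p = weylSp β_J id id` there is `c ∈ ℂˣ` with `(toRep p f)(u) = c · f̂(J u)` for all `f ∈ 𝒮(K^ι)`, `u`.
[cite: MoeglinVignerasWaldspurger1987, Chap. 2 II.1 (A)(B), II.6] [cite: Weil1964, n° 13, p. 160] -/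
theorem exists_toRep_eq_smul_betaFourier (hψ : ψ.IsContinuousNontrivial) (hJ : IsUnit J.det) (hJt : Jᵀ = -J)
    (hb : ∀ y : ι → K, Continuous fun u : ι → K => Matrix.toLinearMap₂' K J u y)
    (hU : ImplementerUniqueUpToScalar (schrodingerSB (Matrix.toLinearMap₂' K J) ψ (isLocallyConstant_of_isContinuousNontrivial hψ) hb))
    (p : MpPsi (schrodingerSB (Matrix.toLinearMap₂' K J) ψ (isLocallyConstant_of_isContinuousNontrivial hψ) hb))
    (hp : MpPsi.proj _ p = weylSp (Matrix.toLinearMap₂' K J) (LinearEquiv.refl K (ι → K)) (LinearEquiv.refl K (ι → K)) (toLinearMap₂'_swap_eq_neg J hJt)) :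
    ∃ c : ℂˣ, ∀ f : SchwartzBruhat (ι → K),
      ((MpPsi.toRep _ p f : SchwartzBruhat (ι → K)) : (ι → K) → ℂ) = (c : ℂ) • betaFourier (Matrix.toLinearMap₂' K J) ψ μ f := by
  obtain ⟨M, hM, hMf⟩ := exists_swap_implementer_coe_eq_betaFourier J ψ μ hψ hJ hJt hb
  obtain ⟨c, hc⟩ := exists_toRep_eq_smul_of_mem _ hU hM p hp
  exact ⟨c, fun f => by rw [hc f, Submodule.coe_smul, hMf f]⟩

end GramFourier

/-! ## §5 BY NAME: pairs of `LocalMpDelta v` over the swap act by `c • betaFourier β_{J_{Δ,v}} ψ_v μ` -/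

section Delta

variable (L : Type) [Field L] [NumberField L] [IsCMField L]
variable {N M n : ℕ} (e : Fin N × Fin M ≃ Fin n)
  (dV : Fin N → L) (hdV : ∀ i, IsCMField.complexConj L (dV i) = dV i) (hdV0 : ∀ i, dV i ≠ 0)
  (dW : Fin M → L) (hdW : ∀ i, IsCMField.complexConj L (dW i) = dW i) (hdW0 : ∀ i, dW i ≠ 0)
  (v : HeightOneSpectrum (𝓞 (Fp L)))

/-- `J_{Δ,v}ᵀ = −J_{Δ,v}` (★ `deltaGram_transpose`). [cite: Kudla1994, §2] -/
theorem deltaGramLoc_transpose : (deltaGramLoc L e dV hdV dW hdW v)ᵀ = -deltaGramLoc L e dV hdV dW hdW v :=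
  deltaGram_transpose (e₂ (n := n)) (gramRLoc L e dV hdV dW hdW v)

include hdV0 hdW0 in
/-- `det J_{Δ,v}` is a unit (★ `isUnit_det_deltaGram` ∘ ★ `isUnit_det_gramRLoc`). [cite: Kudla1994, §2] -/
theorem isUnit_det_deltaGramLoc : IsUnit (deltaGramLoc L e dV hdV dW hdW v).det :=
  isUnit_det_deltaGram (e₂ (n := n)) (gramRLoc L e dV hdV dW hdW v) (isUnit_det_gramRLoc L e dV hdV hdV0 dW hdW hdW0 v)

variable [MeasurableSpace (Fin (n + n) → v.adicCompletion (Fp L))] [BorelSpace (Fin (n + n) → v.adicCompletion (Fp L))]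
  (μ : Measure (Fin (n + n) → v.adicCompletion (Fp L))) [μ.IsAddHaarMeasure]

include hdV0 hdW0 in
/-- **THE WEYL JUNCTION PIN IN (β-1)'s NAMES**: a pair `p : LocalMpDelta v` over the swap `weylSp β_{J_{Δ,v}} id id` — the `ℓ_Δ`-coordinate picture of the Weyl
element `w_Δ` (★ A2d-3 `deltaTransport_iotaD_weylDelta_eq_weylSp`) — acts on `𝒮(X_Δ)` by `toRep p = c • betaFourier β_{J_{Δ,v}} ψ_v μ`, `c ∈ ℂˣ`, for ANY additive
Haar measure `μ` on `X_Δ = L⁺_v^{n+n}` (implementers unique up to scalars: ★ `implementerUniqueUpToScalar_localSchrodingerDelta`).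
[cite: MoeglinVignerasWaldspurger1987, Chap. 2 II.1 (A)(B), II.6] [cite: Kudla1994, §3 Thm. 3.1] [cite: HarrisKudlaSweet1996, §1 (1.11)] -/
theorem exists_toRep_localSchrodingerDelta_eq_smul_betaFourier (p : LocalMpDelta L e dV hdV dW hdW v)
    (hp : MpPsi.proj (localSchrodingerDelta L e dV hdV dW hdW v) p =
      weylSp (Matrix.toLinearMap₂' (v.adicCompletion (Fp L)) (deltaGramLoc L e dV hdV dW hdW v)) (LinearEquiv.refl (v.adicCompletion (Fp L)) _)
        (LinearEquiv.refl (v.adicCompletion (Fp L)) _) (toLinearMap₂'_swap_eq_neg (deltaGramLoc L e dV hdV dW hdW v) (deltaGramLoc_transpose L e dV hdV dW hdW v))) :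
    ∃ c : ℂˣ, ∀ f : SchwartzBruhat (Fin (n + n) → v.adicCompletion (Fp L)),
      ((MpPsi.toRep (localSchrodingerDelta L e dV hdV dW hdW v) p f : SchwartzBruhat (Fin (n + n) → v.adicCompletion (Fp L))) :
          (Fin (n + n) → v.adicCompletion (Fp L)) → ℂ) =
        (c : ℂ) • betaFourier (Matrix.toLinearMap₂' (v.adicCompletion (Fp L)) (deltaGramLoc L e dV hdV dW hdW v)) (adeleAddCharAt (Fp L) v) μ f :=
  exists_toRep_eq_smul_betaFourier (deltaGramLoc L e dV hdV dW hdW v) (adeleAddCharAt (Fp L) v) μ (isContinuousNontrivial_adeleAddCharAt (Fp L) v)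
    (isUnit_det_deltaGramLoc L e dV hdV hdV0 dW hdW hdW0 v) (deltaGramLoc_transpose L e dV hdV dW hdW v)
    (K2LiuDoublingSchrodingerModelDefs.continuous_toLinearMap₂'_left L (deltaGramLoc L e dV hdV dW hdW v))
    (implementerUniqueUpToScalar_localSchrodingerDelta L e dV hdV hdV0 dW hdW hdW0 v) p hp

end Delta

end Summit.HodgeConjecture.HodgeConjecture.Cruxes.HLiu418.K2LiuSchrodingerSwapWeylImplementer

end
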